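import Mathlib
import HarnessLib
import Literature.MathematicalPhysics.KineticTheory.VelocityFlipNoise
import Summits.AtomisticToContinuum.FouriersLaw.Theorems.VanishingNoiseTransferNoisyFourierAbelCorrectorExists

/-!
# Autocorrelations under a Markov family leaving a probability measure invariant; the classical representative
# of the mild Abel corrector
(`--supports stmt-AtomisticToContinuum-11977` helper file, crux `VanishingNoiseTransfer.NoisyFourier`, line
`abel-storage-decay`, registered stub `stub_timeProfileMatching`, half T1 = the fixed-`L` time-profile
representation of the Abel pairing; worker T1 of lead c6, part 4a — the model-independent measure theory of the
time profile `c(t) = ⟨f, V_t f⟩_μ` and the link "classical corrector = mild corrector a.e.")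

* `integrable_mul_integral_of_invariant` — for a Markov kernel `κ` with `μ κ = μ` (`μ` a probability measure) and
  `f ∈ L²(μ)`: `f · κ f ∈ L¹(μ)` and `∫ |f · κ f| dμ ≤ ‖f‖²` (a.e. Jensen + AM–GM; no semigroup property);
* `measurable_autocorr` — `t ↦ ∫ f · V_{t⁺} f dμ` is measurable for a jointly measurable kernel family `V`;
* `integral_mul_laplace` — Fubini: `∫ f (∫ Exp_s(dt) V_t f) dμ = ∫₀^∞ s e^{-st} ⟨f, V_t f⟩_μ dt` when every `V_t`
  leaves `μ` invariant;
* `integral_expMeasure_integral_eq_of_hasSum` — a Laplace–Neumann identity for nonnegative observables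
  (`∫ Exp_s(dt) V_t φ = Σ_n p_n W_n φ`) passes to signed `f` with `Σ_n p_n W_n |f| < ∞`;
* `exists_classical_aeEq_mild` — the pipeline of `stub_abelCorrectorExists` (…NoisyFourierAbelCorrectorExists) re-run
  with the link exposed: the mild Abel corrector `u⋆` of the velocity-flip pinned chain is Lebesgue-a.e. equal to a
  classical corrector `v ∈ C² ∩ L²(μ_T)`.

Registered sub-goal: `helper_invariantKernelAutocorrBound`. No definitions. References: folklore; Bernardin–Olla
2011 §5 (the resolvent corrector).
-/

noncomputable section

open MeasureTheory ProbabilityTheory Filter Topology Set Function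
open scoped NNReal ENNReal BigOperators ContDiff
open Literature.MathematicalPhysics.KineticTheory.HeatConduction
open Literature.Probability.Process OscillatorChain
open Summit.AtomisticToContinuum.FouriersLaw.Theorems.VanishingNoiseBound
  (flip_classical_of_weak_smooth abs_le_of_ae_eq_of_continuous)

namespace Summit.AtomisticToContinuum.FouriersLaw.Cruxes.NoisyFourier.AbelKapitzaEvenCorrector

namespace AbelTimeProfile

/-! ## Markov kernels leaving a probability measure invariant: autocorrelations of `L²` observables -/

section Abstract

variable {X : Type*} [MeasurableSpace X]

/-- **`|⟨f, κ f⟩_μ| ≤ ‖f‖²_{L²(μ)}` for a Markov kernel leaving the probability measure `μ` invariant**: for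
`f ∈ L²(μ)` strongly measurable, `z ↦ f(z) ∫ f dκ(z, ·)` is `μ`-integrable and `∫ |f · κ f| dμ ≤ ∫ f² dμ`
(`f, f² ∈ L¹(κ(z, ·))` for `μ`-a.e. `z` by invariance; Jensen `(κ f)² ≤ κ(f²)` there; AM–GM). [folklore] -/
theorem integrable_mul_integral_of_invariant {μ : Measure X} [IsProbabilityMeasure μ]
    (κ : Kernel X X) [IsMarkovKernel κ] (hinv : μ.bind κ = μ) {f : X → ℝ} (hfm : StronglyMeasurable f)
    (hf2 : MemLp f 2 μ) :
    Integrable (fun z => f z * ∫ y, f y ∂(κ z)) μ ∧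
      ∫ z, |f z * ∫ y, f y ∂(κ z)| ∂μ ≤ ∫ z, f z ^ 2 ∂μ := by
  have hf1 : Integrable f μ := hf2.integrable one_le_two
  have hfsq : Integrable (fun y => f y ^ 2) μ := hf2.integrable_sq
  have hc : κ ∘ₘ μ = μ := hinv
  have h' : (κ ∘ₖ Kernel.const Unit μ) () = μ := by rw [← Measure.comp_eq_comp_const_apply]; exact hc
  have hfsq' : Integrable (fun y => f y ^ 2) ((κ ∘ₖ Kernel.const Unit μ) ()) := by rw [h']; exact hfsq
  -- a.e. integrability under `κ z`
  have hae1 : ∀ᵐ z ∂μ, Integrable f (κ z) :=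
    Measure.ae_integrable_of_integrable_comp (by rw [hc]; exact hf1)
  have hae2 : ∀ᵐ z ∂μ, Integrable (fun y => f y ^ 2) (κ z) :=
    Measure.ae_integrable_of_integrable_comp (by rw [hc]; exact hfsq)
  set g : X → ℝ := fun z => ∫ y, f y ∂(κ z) with hg
  have hgm : StronglyMeasurable g := hfm.integral_kernel (κ := κ)
  -- Jensen, almost everywhere
  have hjensen : ∀ᵐ z ∂μ, g z ^ 2 ≤ ∫ y, f y ^ 2 ∂(κ z) := by
    filter_upwards [hae1, hae2] with z h1 h2
    have hvar : 0 ≤ ∫ y, (f y - g z) ^ 2 ∂(κ z) := integral_nonneg fun y => sq_nonneg _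
    have hexp : ∫ y, (f y - g z) ^ 2 ∂(κ z) = (∫ y, f y ^ 2 ∂(κ z)) - g z ^ 2 := by
      have e : (fun y => (f y - g z) ^ 2) = fun y => f y ^ 2 - (2 * g z) * f y + g z ^ 2 := by
        funext y; ring
      have i1 : Integrable (fun y => f y ^ 2 - 2 * g z * f y) (κ z) := h2.sub (h1.const_mul _)
      rw [e, integral_add i1 (integrable_const _), integral_sub h2 (h1.const_mul _),
        integral_const_mul, integral_const]
      simp only [probReal_univ, smul_eq_mul, one_mul]
      rw [show (∫ y, f y ∂(κ z)) = g z from rfl]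
      ring
    linarith
  -- `κ (f²) ∈ L¹(μ)` with integral `∫ f² dμ`
  have hP2int : Integrable (fun z => ∫ y, f y ^ 2 ∂(κ z)) μ := by
    have := hfsq'.integral_comp
    rwa [Kernel.const_apply] at this
  have hP2val : ∫ z, (∫ y, f y ^ 2 ∂(κ z)) ∂μ = ∫ z, f z ^ 2 ∂μ := by
    have := Kernel.integral_comp hfsq'
    rw [h', Kernel.const_apply] at this
    exact this.symm
  have hg2int : Integrable (fun z => g z ^ 2) μ :=
    hP2int.mono' (hgm.measurable.pow_const 2).aestronglyMeasurable (by
      filter_upwards [hjensen] with z hz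
      rw [Real.norm_eq_abs, abs_of_nonneg (sq_nonneg _)]
      exact hz)
  have hg2le : ∫ z, g z ^ 2 ∂μ ≤ ∫ z, f z ^ 2 ∂μ := by
    rw [← hP2val]
    exact integral_mono_ae hg2int hP2int hjensen
  -- AM–GM
  have hpt : ∀ z, |f z * g z| ≤ (f z ^ 2 + g z ^ 2) / 2 := fun z => by
    rw [abs_mul]
    nlinarith [sq_nonneg (|f z| - |g z|), sq_abs (f z), sq_abs (g z), abs_nonneg (f z), abs_nonneg (g z)]
  have hprod : Integrable (fun z => f z * g z) μ :=
    ((hfsq.add hg2int).div_const 2).mono' (hfm.aestronglyMeasurable.mul hgm.aestronglyMeasurable)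
      (Eventually.of_forall fun z => by rw [Real.norm_eq_abs]; exact hpt z)
  refine ⟨hprod, ?_⟩
  calc ∫ z, |f z * g z| ∂μ ≤ ∫ z, (f z ^ 2 + g z ^ 2) / 2 ∂μ :=
        integral_mono hprod.abs ((hfsq.add hg2int).div_const 2) hpt
    _ = ((∫ z, f z ^ 2 ∂μ) + ∫ z, g z ^ 2 ∂μ) / 2 := by rw [integral_div, integral_add hfsq hg2int]
    _ ≤ ∫ z, f z ^ 2 ∂μ := by linarith

variable (V : ℝ≥0 → Kernel X X)

/-- Joint measurability of `(z, t) ↦ ∫ f dV_{t⁺}(z, ·)` for a measurable kernel family. [folklore] -/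
theorem stronglyMeasurable_integral_family (hmeas : Measurable fun p : ℝ≥0 × X => V p.1 p.2)
    {f : X → ℝ} (hf : StronglyMeasurable f) :
    StronglyMeasurable fun p : X × ℝ => ∫ y, f y ∂(V p.2.toNNReal p.1) := by
  -- adapted from `stronglyMeasurable_integral_kernel_uncurry` (…VanishingNoiseBoundFlipInvariantSteady)
  let K' : Kernel (ℝ≥0 × X) X := ⟨fun p => V p.1 p.2, hmeas⟩
  have h1 : StronglyMeasurable fun p : ℝ≥0 × X => ∫ y, f y ∂(K' p) := hf.integral_kernel (κ := K')
  exact h1.comp_measurable ((measurable_snd.real_toNNReal).prodMk measurable_fst)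

/-- **Measurability of the time profile** `t ↦ ∫ f(z) (∫ f dV_{t⁺}(z, ·)) dμ(z)`. [folklore] -/
theorem measurable_autocorr (hmeas : Measurable fun p : ℝ≥0 × X => V p.1 p.2) (μ : Measure X) [SFinite μ]
    {f : X → ℝ} (hf : StronglyMeasurable f) :
    Measurable fun t : ℝ => ∫ z, f z * ∫ y, f y ∂(V t.toNNReal z) ∂μ := by
  have hF : StronglyMeasurable fun p : X × ℝ => f p.1 * ∫ y, f y ∂(V p.2.toNNReal p.1) :=
    (hf.comp_measurable measurable_fst).mul (stronglyMeasurable_integral_family V hmeas hf)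
  exact (hF.integral_prod_left' (μ := μ)).measurable

/-- **Fubini for the Laplace-weighted time profile.** For a measurable family of Markov kernels `V_t` leaving the
probability measure `μ` invariant, `f ∈ L²(μ)` strongly measurable and `s > 0`:
`∫ f(z) (∫ Exp_s(dt) ∫ f dV_t(z, ·)) dμ(z) = ∫₀^∞ s e^{-st} (∫ f · V_t f dμ) dt` — the integrand
`(z, t) ↦ f(z) (V_t f)(z)` is `μ ⊗ Exp_s`-integrable because `∫ |f · V_t f| dμ ≤ ‖f‖²` for every `t`. [folklore] -/
theorem integral_mul_laplace [∀ t, IsMarkovKernel (V t)] (hmeas : Measurable fun p : ℝ≥0 × X => V p.1 p.2)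
    {μ : Measure X} [IsProbabilityMeasure μ] (hinv : ∀ t, μ.bind (V t) = μ) {f : X → ℝ}
    (hfm : StronglyMeasurable f) (hf2 : MemLp f 2 μ) {s : ℝ} (hs : 0 < s) :
    ∫ z, f z * (∫ t, (∫ y, f y ∂(V t.toNNReal z)) ∂(expMeasure s)) ∂μ =
      ∫ t in Ioi (0:ℝ), s * Real.exp (-(s * t)) * ∫ z, f z * (∫ y, f y ∂(V t.toNNReal z)) ∂μ := by
  haveI := isProbabilityMeasure_expMeasure hs
  set F : X × ℝ → ℝ := fun p => f p.1 * ∫ y, f y ∂(V p.2.toNNReal p.1) with hF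
  have hFm : StronglyMeasurable F :=
    (hfm.comp_measurable measurable_fst).mul (stronglyMeasurable_integral_family V hmeas hfm)
  have hE1 : ∀ t : ℝ, Integrable (fun z => F (z, t)) μ ∧ ∫ z, ‖F (z, t)‖ ∂μ ≤ ∫ z, f z ^ 2 ∂μ := by
    intro t
    have h := integrable_mul_integral_of_invariant (V t.toNNReal) (hinv _) hfm hf2
    exact ⟨h.1, by simpa only [Real.norm_eq_abs] using h.2⟩
  have hint : Integrable F (μ.prod (expMeasure s)) := by
    rw [integrable_prod_iff' hFm.aestronglyMeasurable]
    refine ⟨Eventually.of_forall fun t => (hE1 t).1, ?_⟩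
    refine (integrable_const (∫ z, f z ^ 2 ∂μ)).mono' (hFm.norm.integral_prod_left').aestronglyMeasurable
      (Eventually.of_forall fun t => ?_)
    rw [Real.norm_eq_abs, abs_of_nonneg (integral_nonneg fun z => norm_nonneg _)]
    exact (hE1 t).2
  have hint' : Integrable (uncurry fun z t => F (z, t)) (μ.prod (expMeasure s)) := hint
  calc ∫ z, f z * (∫ t, (∫ y, f y ∂(V t.toNNReal z)) ∂(expMeasure s)) ∂μ
      = ∫ z, ∫ t, F (z, t) ∂(expMeasure s) ∂μ := by
        refine integral_congr_ae (Eventually.of_forall fun z => ?_)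
        exact (integral_const_mul _ _).symm
    _ = ∫ t, ∫ z, F (z, t) ∂μ ∂(expMeasure s) := integral_integral_swap hint'
    _ = ∫ t in Ioi (0:ℝ), s * Real.exp (-(s * t)) * ∫ z, F (z, t) ∂μ :=
        integral_expMeasure_eq_integral_Ioi hs _

/-- **The Laplace transform of `t ↦ (V_t f)(z)` from a Laplace–Neumann identity.** If for every measurable `φ ≥ 0`
`∫ Exp_s(dt) ∫ φ dV_t(z, ·) = Σ_n p_n ∫ φ dW_n` (`p_n ≥ 0`; `Exp_s` Mathlib's exponential law), and a measurable real `f` has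
`Σ_n p_n ∫ |f| dW_n < ∞` and `Σ_n p_n ∫ f dW_n = S`, then `∫ Exp_s(dt) ∫ f dV_t(z, ·) = S`
(the law of `V_t(z, ·)` mixed over `t ∼ Exp_s` is the measure `Σ_n p_n W_n`). [folklore] -/
theorem integral_expMeasure_integral_eq_of_hasSum [∀ t, IsMarkovKernel (V t)]
    (hmeas : Measurable fun p : ℝ≥0 × X => V p.1 p.2) (s : ℝ) (p : ℕ → ℝ) (hp : ∀ n, 0 ≤ p n)
    (Wz : ℕ → Measure X) (z : X)
    (hlap : ∀ φ : X → ℝ≥0∞, Measurable φ →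
      ∫⁻ t, ∫⁻ y, φ y ∂(V t.toNNReal z) ∂(expMeasure s) = ∑' n, ENNReal.ofReal (p n) * ∫⁻ y, φ y ∂(Wz n))
    {f : X → ℝ} (hfm : Measurable f) (hfin : (∑' n, ENNReal.ofReal (p n) * ∫⁻ y, ‖f y‖ₑ ∂(Wz n)) ≠ ⊤)
    {S : ℝ} (hsum : HasSum (fun n => p n * ∫ y, f y ∂(Wz n)) S) :
    ∫ t, (∫ y, f y ∂(V t.toNNReal z)) ∂(expMeasure s) = S := by
  let Vk : Kernel (ℝ≥0 × X) X := ⟨fun q => V q.1 q.2, hmeas⟩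
  let κ : Kernel ℝ X := Vk.comap (fun t : ℝ => (t.toNNReal, z)) (by fun_prop)
  have hκ : ∀ t, κ t = V t.toNNReal z := fun t => rfl
  haveI : IsMarkovKernel κ := ⟨fun t => by rw [hκ]; infer_instance⟩
  set ν : Measure X := Measure.sum fun n => ENNReal.ofReal (p n) • Wz n with hν
  have hbind : κ ∘ₘ expMeasure s = ν := by
    refine Measure.ext_of_lintegral _ fun φ hφ => ?_
    rw [Measure.lintegral_bind (Kernel.aemeasurable κ) hφ.aemeasurable, hν, lintegral_sum_measure]
    simp_rw [lintegral_smul_measure, smul_eq_mul, hκ]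
    exact hlap φ hφ
  have hintν : Integrable f ν := by
    refine ⟨hfm.aestronglyMeasurable, ?_⟩
    show ∫⁻ y, ‖f y‖ₑ ∂ν < ⊤
    rw [hν, lintegral_sum_measure]
    simp_rw [lintegral_smul_measure, smul_eq_mul]
    exact hfin.lt_top
  have hint : Integrable f ((κ ∘ₖ Kernel.const Unit (expMeasure s)) ()) := by
    rw [← Measure.comp_eq_comp_const_apply, hbind]; exact hintν
  calc ∫ t, (∫ y, f y ∂(V t.toNNReal z)) ∂(expMeasure s)
      = ∫ t, ∫ y, f y ∂(κ t) ∂(Kernel.const Unit (expMeasure s) ()) := by rw [Kernel.const_apply]; rfl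
    _ = ∫ y, f y ∂((κ ∘ₖ Kernel.const Unit (expMeasure s)) ()) := (Kernel.integral_comp hint).symm
    _ = ∫ y, f y ∂ν := by rw [← Measure.comp_eq_comp_const_apply, hbind]
    _ = ∑' n, ∫ y, f y ∂(ENNReal.ofReal (p n) • Wz n) := by rw [hν] at hintν ⊢; exact integral_sum_measure hintν
    _ = ∑' n, p n * ∫ y, f y ∂(Wz n) := by
        refine tsum_congr fun n => ?_
        rw [integral_smul_measure, ENNReal.toReal_ofReal (hp n), smul_eq_mul]
    _ = S := hsum.tsum_eq

end Abstract

/-! ## The classical representative of the mild Abel corrector -/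

section Chain

variable {ω₂ lam β γ : ℝ} {L : ℕ}

/-- **A classical Abel corrector a.e. equal to the mild one** (the pipeline of `stub_abelCorrectorExists`, with the
link kept): for the pinned chain (all parameters `> 0`), `L ≥ 2`, `T > 0`, `ε > 0`, `s > 0` there are the mild
corrector `u⋆` of `abel_mildCorrector_exists` (measurable, `|u⋆| ≤ C e^{H/(4T)}`, mild equation at every point) and a
classical corrector `v ∈ C² ∩ L²(μ_T)`, `L_ε v = s v − J` pointwise, with `u⋆ = v` Lebesgue-a.e.
[cite: BernardinOlla2011, §5] -/
theorem exists_classical_aeEq_mild (hω : 0 < ω₂) (hl : 0 < lam) (hβ : 0 < β) (hγ : 0 < γ) (hL : 2 ≤ L)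
    {T : ℝ} (hT : 0 < T) {ε : ℝ} (hε : 0 < ε) {s : ℝ} (hs : 0 < s) :
    ∃ u v : PhaseSpace L → ℝ, Measurable u ∧
      (∃ C : ℝ, ∀ z, |u z| ≤ C * Real.exp (1 / (4 * T) * (pinnedChain ω₂ lam β γ).hamiltonian L z)) ∧
      (∀ z, u z = ∫ y, (s + (L : ℝ) * ε)⁻¹ * ((∑ i : Fin L, (pinnedChain ω₂ lam β γ).bondCurrent L i y) +
          ε * ∑ i : Fin L, u (momentumFlip i y))
        ∂((pinnedChainSemigroup hω hl.le hβ.le hγ.le (by omega) hT.le hT.le).resolventKernel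
          (s + (L : ℝ) * ε) z)) ∧
      ContDiff ℝ 2 v ∧ MemLp v 2 ((pinnedChain ω₂ lam β γ).gibbsMeasure L T) ∧
      (∀ x, (pinnedChain ω₂ lam β γ).flipGenerator L T T ε v x =
        s * v x - ∑ i : Fin L, (pinnedChain ω₂ lam β γ).bondCurrent L i x) ∧
      ∀ᵐ x ∂(volume : Measure (PhaseSpace L)), u x = v x := by
  -- adapted from `stub_abelCorrectorExists` (…NoisyFourierAbelCorrectorExists): same pipeline, link exposed
  have hL1 : 1 < L := by omega
  have hL0 : 0 < L := by omega
  set P := pinnedChain ω₂ lam β γ with hP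
  have hU : ContDiff ℝ ∞ P.U := pinnedChain_contDiff_U ω₂ lam β γ
  have hV : ContDiff ℝ ∞ P.V := pinnedChain_contDiff_V ω₂ lam β γ
  have hγ' : P.γ = γ := rfl
  have hγT : 0 ≤ P.γ * T := by rw [hγ']; positivity
  obtain ⟨u, hum, hub, hmild⟩ := abel_mildCorrector_exists (N := L) hω hl hβ hγ hL1 hT hε hs
  have hweak := abel_mild_weak hω hl hβ hγ hL hT hε hs hum hub hmild
  obtain ⟨v, hvs, hae⟩ := abel_weak_smooth hβ hγ hL hT hT ε s hum
    (hub.imp fun C hC => ⟨1 / (4 * T), hC⟩) hweak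
  have hJc : Continuous fun x : PhaseSpace L => ∑ i : Fin L, P.bondCurrent L i x :=
    continuous_finsetSum _ fun i _ => pinnedChain_continuous_bondCurrent ω₂ lam β γ L i
  have hFc : Continuous fun x : PhaseSpace L => s * v x - ∑ i : Fin L, P.bondCurrent L i x :=
    (continuous_const.mul hvs.continuous).sub hJc
  have hweakv : ∀ φ : PhaseSpace L → ℝ, ContDiff ℝ ∞ φ → HasCompactSupport φ →
      ∫ x, v x * (-(P.generator L T T φ x) +
          2 * P.γ * (T * partialP (⟨0, hL0⟩ : Fin L) (partialP (⟨0, hL0⟩ : Fin L) φ) x +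
            T * partialP (⟨L - 1, Nat.sub_lt hL0 one_pos⟩ : Fin L)
              (partialP (⟨L - 1, Nat.sub_lt hL0 one_pos⟩ : Fin L) φ) x) +
          2 * P.γ * φ x + ε * flipNoise L φ x) =
        ∫ x, (s * v x - ∑ i : Fin L, P.bondCurrent L i x) * φ x := by
    intro φ hφ hφc
    have h1 := hweak φ hφ hφc
    rw [hγ']
    have e1 : (fun x => v x * (-(P.generator L T T φ x) +
          2 * γ * (T * partialP (⟨0, hL0⟩ : Fin L) (partialP (⟨0, hL0⟩ : Fin L) φ) x +
            T * partialP (⟨L - 1, Nat.sub_lt hL0 one_pos⟩ : Fin L)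
              (partialP (⟨L - 1, Nat.sub_lt hL0 one_pos⟩ : Fin L) φ) x) +
          2 * γ * φ x + ε * flipNoise L φ x)) =ᵐ[volume]
        fun x => u x * (-(P.generator L T T φ x) +
          2 * γ * (T * partialP (⟨0, hL0⟩ : Fin L) (partialP (⟨0, hL0⟩ : Fin L) φ) x +
            T * partialP (⟨L - 1, Nat.sub_lt hL0 one_pos⟩ : Fin L)
              (partialP (⟨L - 1, Nat.sub_lt hL0 one_pos⟩ : Fin L) φ) x) +
          2 * γ * φ x + ε * flipNoise L φ x) := by
      filter_upwards [hae] with x hx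
      rw [hx]
    have e2 : (fun x => (s * v x - ∑ i : Fin L, P.bondCurrent L i x) * φ x) =ᵐ[volume]
        fun x => (s * u x - ∑ i : Fin L, P.bondCurrent L i x) * φ x := by
      filter_upwards [hae] with x hx
      rw [hx]
    rw [integral_congr_ae e1, integral_congr_ae e2]
    exact h1
  have hclass := flip_classical_of_weak_smooth P hU hV hL0 hγT hγT ε (u := v)
    (F := fun x => s * v x - ∑ i : Fin L, P.bondCurrent L i x) hvs hFc hweakv
  obtain ⟨C, hC⟩ := hub
  have hBc : Continuous fun z : PhaseSpace L => C * Real.exp (1 / (4 * T) * P.hamiltonian L z) :=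
    continuous_const.mul (Real.continuous_exp.comp
      (continuous_const.mul (pinnedChain_continuous_hamiltonian ω₂ lam β γ L)))
  have hvb : ∀ z, |v z| ≤ C * Real.exp (1 / (4 * T) * P.hamiltonian L z) :=
    abs_le_of_ae_eq_of_continuous hvs.continuous hBc hC hae
  have hmem : MemLp v 2 (P.gibbsMeasure L T) :=
    memLp_two_of_abs_le_exp_quarter hω hl.le hβ.le γ hT hvs.continuous hvb
  refine ⟨u, v, hum, ⟨C, hC⟩, hmild, hvs.of_le (by norm_cast), hmem, fun x => ?_, hae⟩
  rw [OscillatorChain.flipGenerator_eq_add_flipNoise, hclass x]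

end Chain

/-- **Registered sub-goal `helper_invariantKernelAutocorrBound`** of stmt-AtomisticToContinuum-11977 (brick for the T1 half of
stub `stub_timeProfileMatching`, line `abel-storage-decay`): `integrable_mul_integral_of_invariant` on the phase space of
the `N`-particle chain, fully quantified and notation-free. [folklore] -/
theorem helper_invariantKernelAutocorrBound : ∀ (N : ℕ) (μ : MeasureTheory.Measure (Literature.MathematicalPhysics.KineticTheory.HeatConduction.PhaseSpace N)) [MeasureTheory.IsProbabilityMeasure μ] (κ : ProbabilityTheory.Kernel (Literature.MathematicalPhysics.KineticTheory.HeatConduction.PhaseSpace N) (Literature.MathematicalPhysics.KineticTheory.HeatConduction.PhaseSpace N)) [ProbabilityTheory.IsMarkovKernel κ], μ.bind κ = μ → ∀ f : Literature.MathematicalPhysics.KineticTheory.HeatConduction.PhaseSpace N → ℝ, MeasureTheory.StronglyMeasurable f → MeasureTheory.MemLp f 2 μ → MeasureTheory.Integrable (fun z => f z * MeasureTheory.integral (κ z) (fun y => f y)) μ ∧ MeasureTheory.integral μ (fun z => |f z * MeasureTheory.integral (κ z) (fun y => f y)|) ≤ MeasureTheory.integral μ (fun z => f z ^ 2) :=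
  fun _ _ _ κ _ hinv _ hfm hf2 => integrable_mul_integral_of_invariant κ hinv hfm hf2

end AbelTimeProfile

end Summit.AtomisticToContinuum.FouriersLaw.Cruxes.NoisyFourier.AbelKapitzaEvenCorrector

end
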